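import Summits.ResolutionOfSingularities.ResolutionOfSingularities.Theorems.FrobeniusLadderFInjectiveMacaulayficationPointFixableChartTransfer
import Summits.ResolutionOfSingularities.ResolutionOfSingularities.Theorems.FrobeniusLadderFInjectiveMacaulayficationPointFixableChartSwap
import Mathlib.RingTheory.Nakayama
import HarnessLib

/-!
# §T2 / 5i `pointFixable_adicTransfer`: `PFix` is invariant along 𝔪-adically bijective flat local maps of Noetherian local domains
# (crux `FInjectiveMacaulayfication` stmt-ResolutionOfSingularities-15315, chain w45a, T-𝒫-loc)

[OURS · L1 W4.5a · res-D-pv-019 AS res-L1-w45a-stub-7] Support file (`--supports stmt-ResolutionOfSingularities-15315 --as helper`)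
for the crux `FrobeniusLadder.FInjectiveMacaulayfication`; NOT a statement of any manuscript; AI-written, weaker than expert review.
Statement = §T2 `stub_pointFixable_adicTransfer` of the strategist's sketch file `L/res-L1-w45a-strat-1/PFixTowerSig.lean` r2 sha16
b235fde4a11e66a6 (l.145–160) VERBATIM with the `stub_` prefix dropped (rulings R12.9 (d) / R12.11 (d) of res-L1-w45a-plan-1:
«5i ASSIGNED to stub-7»).

THE THEOREM (`pointFixable_adicTransfer`). `A → B` a flat local homomorphism of Noetherian local DOMAINS with `𝔪_A B = 𝔪_B` and
`A → B/𝔪_B^m` surjective for all `m` (completion when it is a domain, henselisation, the local ring of an étale neighbourhood with the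
same residue field). Then `PFix A ↔ PFix B`, where `PFix R` = «some tuple `c` with `(c) ≠ 0`, `√(c) = 𝔪_R`, such that every local
ring of every chart `R[(c)/c_j]` over `𝔪_R` is a domain satisfying the Cohen–Macaulay + Frobenius-closed clause» (ClassGlueSig v3 5b′).

PROOF (assembly of three landed support files).
* `A ⇒ B` with `c ↦ φ∘c`: a prime `𝔔'` of `B[(φc)/φc_j]` over `𝔪_B` contracts to `𝔔 = ψ⁻¹𝔔'` over `𝔪_A`
  (`PointFixableChartTransfer.comap_comap_eq_maximalIdeal`), and the clause moves up along the flat, local, dense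
  `A[(c)/c_j]_𝔔 → B[(φc)/φc_j]_𝔔'` (`PointFixableChartTransfer.fiClause_atPrime_iff`, p518156, built on the flat base change
  `B[(φc)/φc_j] = B ⊗_A A[(c)/c_j]`, p515956, and §T2a `FiClauseAdicTransfer.fiClause_adicTransfer`, p513273).
* `B ⇒ A`: NAKAYAMA replaces the `B`-tuple `c'` by `φ∘a` for an `A`-tuple `a` with `(φa)B = (c')B`; a prime `𝔔` of `A[(a)/a_j]`
  over `𝔪_A` lifts to a prime `𝔔'` of `B[(c')/φa_j]` over `𝔪_B` (`PointFixableChartTransfer.exists_prime_over`, faithful flatness);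
  the CHART SWAP (`PointFixableChartSwap.exists_chart_atPrime_ringEquiv`, p519346) identifies `B[(c')/φa_j]_𝔔'` with a local ring
  `B[(c')/c'_i]_{𝔔_i}` over `𝔪_B` of one of the GIVEN charts, where the hypothesis holds; transport (`DegreeZeroDescent.inlineClause_of_ringEquiv`)
  and descend (`fiClause_atPrime_iff`).
* `IsDomain` of the localized chart algebras is automatic: `R[(c)/c_j] ⊆ R[1/c_j]` is a domain for `c_j ≠ 0`, and has no primes
  for `c_j = 0`. No named facts; any `p : ℕ`.
-/

-- single-problem summit: the doubled namespace component is forced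
set_option linter.dupNamespace false
-- the VERBATIM sketch statement carries `[IsLocalRing A] [IsDomain A]` (both imply `Nontrivial A`), as in `PFixTowerSig.lean`
set_option linter.overlappingInstances false

noncomputable section

namespace Summit.ResolutionOfSingularities.ResolutionOfSingularities.Theorems.FInjectiveMacaulayfication.PointFixableAdicTransfer

open IsLocalRing Literature.AlgebraicGeometry.Resolution
open Summit.ResolutionOfSingularities.ResolutionOfSingularities.Theorems.FInjectiveMacaulayfication

/-! ## Small lemmas -/

/-- The affine blowup algebra `R[I/0] ⊆ R[1/0] = 0` has no prime ideals. [folklore] -/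
theorem false_of_prime_blowupAlgebra_zero {R : Type*} [CommRing R] (I : Ideal R) {a : R} (ha : a = 0)
    (𝔔 : Ideal (blowupAlgebra I a)) [𝔔.IsPrime] : False := by
  haveI : Subsingleton (Localization.Away a) :=
    IsLocalization.subsingleton (M := Submonoid.powers a) (S := Localization.Away a) ⟨1, by simp only [pow_one, ha]⟩
  exact ‹𝔔.IsPrime›.ne_top (Subsingleton.elim _ _)

/-- For `a ≠ 0` in a domain `R`, every local ring `R[I/a]_𝔔` of the affine blowup algebra `R[I/a] ⊆ R[1/a]` is a domain.
[folklore] -/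
theorem isDomain_atPrime_blowupAlgebra {R : Type*} [CommRing R] [IsDomain R] (I : Ideal R) {a : R} (ha : a ≠ 0)
    (𝔔 : Ideal (blowupAlgebra I a)) [𝔔.IsPrime] : IsDomain (Localization.AtPrime 𝔔) := by
  haveI : IsDomain (Localization.Away a) :=
    IsLocalization.isDomain_localization (powers_le_nonZeroDivisors_of_noZeroDivisors ha)
  haveI : IsDomain (blowupAlgebra I a) := Subalgebra.isDomain _
  exact IsLocalization.isDomain_localization
    (le_nonZeroDivisors_of_noZeroDivisors fun h => ‹𝔔.IsPrime›.ne_top ((Ideal.eq_top_iff_one _).mpr (by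
      have h0 : (0 : blowupAlgebra I a) ∈ 𝔔 := 𝔔.zero_mem
      exact absurd h0 h)))

/-- `(φ ∘ c) = (c)·B` as ideals. [folklore] -/
theorem span_range_comp {A B : Type*} [CommRing A] [CommRing B] (φ : A →+* B) {n : ℕ} (c : Fin n → A) :
    Ideal.span (Set.range fun j => φ (c j)) = (Ideal.span (Set.range c)).map φ := by
  rw [Ideal.map_span, ← Set.range_comp]
  rfl

/-! ## 5i -/

/-- **§T2 / 5i — `PFix` IS INVARIANT ALONG 𝔪-ADICALLY BIJECTIVE FLAT LOCAL MAPS OF NOETHERIAN LOCAL DOMAINS**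
(`PFixTowerSig` r2 b235fde4a11e66a6 `stub_pointFixable_adicTransfer`, l.145–160, verbatim): for `A → B` flat local with
`𝔪_A B = 𝔪_B` and `A → B/𝔪_B^m` onto for all `m`, `A`, `B` Noetherian local domains, the point-fixability predicate `PFix`
(ClassGlueSig v3 5b′, inline) holds for `A` iff it holds for `B`. Assembly of p515956 (flat base change of blowup algebras),
p518156 (chart-level adic transfer), p519346 (chart swap) and §T2a p513273; see the module docstring. [folklore] -/
theorem pointFixable_adicTransfer : ∀ (p : ℕ) (A B : Type) [CommRing A] [IsLocalRing A] [IsNoetherianRing A] [IsDomain A]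
    [CommRing B] [IsLocalRing B] [IsNoetherianRing B] [IsDomain B] [Algebra A B] [IsLocalHom (algebraMap A B)] [Module.Flat A B],
    (IsLocalRing.maximalIdeal A).map (algebraMap A B) = IsLocalRing.maximalIdeal B →
    (∀ m : ℕ, Function.Surjective (fun a : A => Ideal.Quotient.mk (IsLocalRing.maximalIdeal B ^ m) (algebraMap A B a))) →
    ((∃ (n : ℕ) (c : Fin n → A), Ideal.span (Set.range c) ≠ ⊥ ∧ (Ideal.span (Set.range c)).radical = IsLocalRing.maximalIdeal (A) ∧
        ∀ (j : Fin n) (𝔔 : PrimeSpectrum (Literature.AlgebraicGeometry.Resolution.blowupAlgebra (Ideal.span (Set.range c)) (c j))),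
          𝔔.asIdeal.comap (algebraMap (A) (Literature.AlgebraicGeometry.Resolution.blowupAlgebra (Ideal.span (Set.range c)) (c j))) = IsLocalRing.maximalIdeal (A) →
          IsDomain (Localization.AtPrime 𝔔.asIdeal) ∧ ∀ d : ℕ, ringKrullDim (Localization.AtPrime 𝔔.asIdeal) = d → ∀ s : Fin d → Localization.AtPrime 𝔔.asIdeal, (Ideal.span (Set.range s)).radical.IsMaximal → RingTheory.Sequence.IsWeaklyRegular (Localization.AtPrime 𝔔.asIdeal) (List.ofFn s) ∧ ∀ y : Localization.AtPrime 𝔔.asIdeal, (∃ e : ℕ, y ^ p ^ e ∈ Ideal.span ((fun z : Localization.AtPrime 𝔔.asIdeal => z ^ p ^ e) '' (Ideal.span (Set.range s) : Set (Localization.AtPrime 𝔔.asIdeal)))) → y ∈ Ideal.span (Set.range s)) ↔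
     (∃ (n : ℕ) (c : Fin n → B), Ideal.span (Set.range c) ≠ ⊥ ∧ (Ideal.span (Set.range c)).radical = IsLocalRing.maximalIdeal (B) ∧
        ∀ (j : Fin n) (𝔔 : PrimeSpectrum (Literature.AlgebraicGeometry.Resolution.blowupAlgebra (Ideal.span (Set.range c)) (c j))),
          𝔔.asIdeal.comap (algebraMap (B) (Literature.AlgebraicGeometry.Resolution.blowupAlgebra (Ideal.span (Set.range c)) (c j))) = IsLocalRing.maximalIdeal (B) →
          IsDomain (Localization.AtPrime 𝔔.asIdeal) ∧ ∀ d : ℕ, ringKrullDim (Localization.AtPrime 𝔔.asIdeal) = d → ∀ s : Fin d → Localization.AtPrime 𝔔.asIdeal, (Ideal.span (Set.range s)).radical.IsMaximal → RingTheory.Sequence.IsWeaklyRegular (Localization.AtPrime 𝔔.asIdeal) (List.ofFn s) ∧ ∀ y : Localization.AtPrime 𝔔.asIdeal, (∃ e : ℕ, y ^ p ^ e ∈ Ideal.span ((fun z : Localization.AtPrime 𝔔.asIdeal => z ^ p ^ e) '' (Ideal.span (Set.range s) : Set (Localization.AtPrime 𝔔.asIdeal)))) → y ∈ Ideal.span (Set.range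 s))) := by
  intro p A B _ _ _ _ _ _ _ _ _ _ _ h𝔪 hsurj
  haveI : Module.FaithfullyFlat A B := Module.FaithfullyFlat.of_flat_of_isLocalHom
  -- bookkeeping along `φ = algebraMap A B`
  have hcm : ∀ I : Ideal A, (I.map (algebraMap A B)).comap (algebraMap A B) = I := fun I =>
    Ideal.comap_map_eq_self_of_faithfullyFlat I
  have hinj : Function.Injective (algebraMap A B) := by
    rw [RingHom.injective_iff_ker_eq_bot, RingHom.ker_eq_comap_bot, ← Ideal.map_bot (f := algebraMap A B)]
    exact hcm ⊥
  have happrox : ∀ (m : ℕ) (b : B), ∃ a : A, b - algebraMap A B a ∈ maximalIdeal B ^ m := fun m b => by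
    obtain ⟨a, ha⟩ := hsurj m (Ideal.Quotient.mk _ b)
    exact ⟨a, Ideal.Quotient.eq.mp ha.symm⟩
  have hpow : ∀ m : ℕ, (maximalIdeal A ^ m).map (algebraMap A B) = maximalIdeal B ^ m := fun m => by
    rw [Ideal.map_pow, h𝔪]
  have hprimA : ∀ I : Ideal A, maximalIdeal A ≤ I.radical → ∃ m : ℕ, maximalIdeal A ^ m ≤ I := fun I hI =>
    Ideal.exists_pow_le_of_le_radical_of_fg hI (IsNoetherian.noetherian _)
  have hprimB : ∀ J : Ideal B, maximalIdeal B ≤ J.radical → ∃ m : ℕ, maximalIdeal B ^ m ≤ J := fun J hJ =>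
    Ideal.exists_pow_le_of_le_radical_of_fg hJ (IsNoetherian.noetherian _)
  have hradext : ∀ I : Ideal A, I.radical = maximalIdeal A → (I.map (algebraMap A B)).radical = maximalIdeal B := by
    intro I hI
    obtain ⟨m, hm⟩ := hprimA I hI.ge
    apply le_antisymm
    · refine (Ideal.IsPrime.radical_le_iff inferInstance).mpr ?_
      rw [← h𝔪]
      exact Ideal.map_mono (hI ▸ Ideal.le_radical : I ≤ maximalIdeal A)
    · intro x hx
      exact ⟨m, (hpow m ▸ Ideal.map_mono hm : maximalIdeal B ^ m ≤ _) (Ideal.pow_mem_pow hx m)⟩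
  have hradcomap : ∀ J : Ideal B, J.radical = maximalIdeal B →
      (J.comap (algebraMap A B)).radical = maximalIdeal A := by
    intro J hJ
    rw [← Ideal.comap_radical, hJ, ← h𝔪, hcm]
  -- Nakayama: a tuple of `B` with `𝔪_B`-primary span generates the extension of a tuple of `A`
  have hgen : ∀ {n : ℕ} (s' : Fin n → B), (Ideal.span (Set.range s')).radical = maximalIdeal B →
      ∃ a : Fin n → A, (Ideal.span (Set.range a)).map (algebraMap A B) = Ideal.span (Set.range s') := by
    intro n s' hs'
    obtain ⟨m, hm⟩ := hprimB _ hs'.ge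
    choose a ha using fun i => happrox (m + 1) (s' i)
    have hsm : maximalIdeal B ^ (m + 1) ≤ maximalIdeal B • Ideal.span (Set.range s') := by
      rw [pow_succ', Ideal.smul_eq_mul]
      exact Ideal.mul_mono_right hm
    refine ⟨a, le_antisymm ?_ ?_⟩
    · rw [Ideal.map_le_iff_le_comap, Ideal.span_le]
      rintro _ ⟨i, rfl⟩
      rw [SetLike.mem_coe, Ideal.mem_comap]
      have : algebraMap A B (a i) = s' i - (s' i - algebraMap A B (a i)) := by ring
      rw [this]
      exact sub_mem (Ideal.subset_span ⟨i, rfl⟩) (((Ideal.pow_le_pow_right (Nat.le_succ m)).trans hm) (ha i))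
    · apply Submodule.le_of_le_smul_of_le_jacobson_bot (I := maximalIdeal B)
        (N := (Ideal.span (Set.range a)).map (algebraMap A B)) (IsNoetherian.noetherian _)
        (IsLocalRing.maximalIdeal_le_jacobson _)
      rw [Ideal.span_le]
      rintro _ ⟨i, rfl⟩
      have h1 : algebraMap A B (a i) ∈ (Ideal.span (Set.range a)).map (algebraMap A B) :=
        Ideal.mem_map_of_mem _ (Ideal.subset_span ⟨i, rfl⟩)
      have h2 : s' i - algebraMap A B (a i) ∈ maximalIdeal B • Ideal.span (Set.range s') := hsm (ha i)
      have : s' i = algebraMap A B (a i) + (s' i - algebraMap A B (a i)) := by ring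
      rw [SetLike.mem_coe, this]
      exact Submodule.add_mem_sup h1 h2
  constructor
  · -- `A ⇒ B`, with the tuple `φ ∘ c`
    rintro ⟨n, c, hc0, hcrad, hgood⟩
    have hIJ : (Ideal.span (Set.range c)).map (algebraMap A B) ≤ Ideal.span (Set.range fun j => algebraMap A B (c j)) :=
      (span_range_comp (algebraMap A B) c).ge
    have hJI : Ideal.span (Set.range fun j => algebraMap A B (c j)) ≤ (Ideal.span (Set.range c)).map (algebraMap A B) :=
      (span_range_comp (algebraMap A B) c).le
    refine ⟨n, fun j => algebraMap A B (c j), ?_, ?_, ?_⟩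
    · -- `(φc) ≠ 0`
      intro h
      apply hc0
      rw [span_range_comp, ← le_bot_iff, Ideal.map_le_iff_le_comap] at h
      exact le_bot_iff.mp fun x hx => (RingHom.injective_iff_ker_eq_bot _).mp hinj ▸ h hx
    · rw [span_range_comp]
      exact hradext _ hcrad
    · intro j 𝔔' h𝔔'
      by_cases hcj : c j = 0
      · exact (false_of_prime_blowupAlgebra_zero (Ideal.span (Set.range fun j => algebraMap A B (c j)))
          (by simp only [hcj, map_zero]) 𝔔'.asIdeal).elim
      haveI : (𝔔'.asIdeal.comap (blowupAlgebraMap (algebraMap A B) (Ideal.span (Set.range c))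
          (Ideal.span (Set.range fun j => algebraMap A B (c j))) (c j) hIJ)).IsPrime := Ideal.comap_isPrime _ _
      have h𝔔 := PointFixableChartTransfer.comap_comap_eq_maximalIdeal (Ideal.span (Set.range c))
        (Ideal.span (Set.range fun j => algebraMap A B (c j))) (c j) hIJ h𝔪 𝔔'.asIdeal h𝔔'
      obtain ⟨-, hclA⟩ := hgood j ⟨_, Ideal.comap_isPrime _ 𝔔'.asIdeal⟩ h𝔔
      refine ⟨isDomain_atPrime_blowupAlgebra _ ((map_ne_zero_iff _ hinj).mpr hcj) _, ?_⟩
      exact (PointFixableChartTransfer.fiClause_atPrime_iff (Ideal.span (Set.range c))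
        (Ideal.span (Set.range fun j => algebraMap A B (c j))) (c j) hIJ h𝔪 p hJI hsurj 𝔔'.asIdeal h𝔔' _ rfl).mp hclA
  · -- `B ⇒ A`, with a Nakayama lift `a` of the tuple `c'`
    rintro ⟨n, c', hc0, hcrad, hgood⟩
    obtain ⟨a, ha⟩ := hgen c' hcrad
    have hIJ : (Ideal.span (Set.range a)).map (algebraMap A B) ≤ Ideal.span (Set.range c') := ha.le
    have hJI : Ideal.span (Set.range c') ≤ (Ideal.span (Set.range a)).map (algebraMap A B) := ha.ge
    refine ⟨n, a, ?_, ?_, ?_⟩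
    · intro h
      apply hc0
      rw [← ha, h, Ideal.map_bot]
    · rw [← hcm (Ideal.span (Set.range a)), ha]
      exact hradcomap _ hcrad
    · intro j 𝔔 h𝔔
      by_cases haj : a j = 0
      · exact (false_of_prime_blowupAlgebra_zero (Ideal.span (Set.range a)) haj 𝔔.asIdeal).elim
      -- a prime `𝔔'` of `B[(c')/φ a_j]` over `𝔔` and over `𝔪_B`
      obtain ⟨𝔔', h𝔔'p, h𝔔'𝔔, h𝔔'B⟩ := PointFixableChartTransfer.exists_prime_over (Ideal.span (Set.range a))
        (Ideal.span (Set.range c')) (a j) hIJ h𝔪 hJI 𝔔.asIdeal h𝔔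
      haveI := h𝔔'p
      -- chart swap: a local ring of one of the given charts `B[(c')/c'_i]` over `𝔪_B`
      have hs : algebraMap A B (a j) ∈ Ideal.span (Set.range c') :=
        hIJ (Ideal.mem_map_of_mem _ (Ideal.subset_span ⟨j, rfl⟩))
      have hs0 : algebraMap A B (a j) ≠ 0 := (map_ne_zero_iff _ hinj).mpr haj
      obtain ⟨i, 𝔔ᵢ, hci0, h𝔔ᵢB, ⟨e⟩⟩ := PointFixableChartSwap.exists_chart_atPrime_ringEquiv c' hs hs0 𝔔'
      obtain ⟨-, hclᵢ⟩ := hgood i 𝔔ᵢ (h𝔔ᵢB.trans h𝔔'B)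
      have hcl' := DegreeZeroDescent.inlineClause_of_ringEquiv (L := Localization.AtPrime 𝔔ᵢ.asIdeal)
        (L' := Localization.AtPrime 𝔔') p e hclᵢ
      refine ⟨isDomain_atPrime_blowupAlgebra _ haj _, ?_⟩
      exact (PointFixableChartTransfer.fiClause_atPrime_iff (Ideal.span (Set.range a)) (Ideal.span (Set.range c')) (a j)
        hIJ h𝔪 p hJI hsurj 𝔔' h𝔔'B 𝔔.asIdeal h𝔔'𝔔.symm).mpr hcl'

end Summit.ResolutionOfSingularities.ResolutionOfSingularities.Theorems.FInjectiveMacaulayfication.PointFixableAdicTransfer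

end
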